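import Mathlib.NumberTheory.Chebyshev
import Mathlib.NumberTheory.Padics.PadicVal.Basic
import Mathlib.Logic.Equiv.Fin.Basic
import Mathlib.Tactic
import HarnessLib

/-!
# The identity permutation maximizes the valuation of a column-shaped lcm product
# (Calegari–Dimitrov–Tang, Lemma 65)

In the denominator bookkeeping of their fine holonomy bounds, Calegari–Dimitrov–Tang
[CalegariDimitrovTang2024, §6.6 "Denominator arithmetic", Lemma 65 (p. 55)] use the following
"simple lemma", which is "where the special condition (column shape) on the denominators shape
matrix is used, in all our theorems in §§6, 7":

> **Lemma 65.** For every prime `p`, every vector `(c_1,…,c_m) ∈ ℕ^m` of the form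
> `0 = c_1 = ⋯ = c_u < c_{u+1} = ⋯ = c_m =: c`, and every nondecreasing sequence
> `n(1) ≤ ⋯ ≤ n(km)` of `km` positive integers,
> `max_{π ∈ S_{km}} val_p { ∏_{i=1}^m ∏_{s=1}^k [1,…,c_i·n(π((i-1)k+s))] }`
> ` = val_p { ∏_{i=1}^m ∏_{s=1}^k [1,…,c_i·n((i-1)k+s)] }`;
> in other words the identity permutation maximizes the `p`-adic valuation.

Here `[1,…,N] = lcm(1,…,N)` is Mathlib's `Nat.lcmUpto N`. We prove it as
`padicValNat_shapeLcmProd_le` (every permutation gives valuation `≤` that of the identity), with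
the positions `(i,s)` encoded row-major by `finProdFinEquiv : Fin m × Fin k ≃ Fin (m·k)`
(`(i,s) ↦ s + k·i`, the printed `(i-1)k+s` in `0`-based indexing) and the column shape encoded as
`c i = if i < u then 0 else c₀` (we do not need `c₀ > 0` nor `n ≥ 1`). The proof is the printed
one-liner made explicit: `val_p [1,…,N] = ⌊log_p N⌋` is nondecreasing in `N`, the rows `i ≤ u`
contribute nothing, and for a nondecreasing `g` the sum of `g` over any `t` positions is at most
its sum over the last `t` positions (`sum_le_sum_filter_le`).

## References
* [CalegariDimitrovTang2024] F. Calegari, V. Dimitrov, Y. Tang, *The linear independence of 1,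
  ζ(2) and L(2, χ₋₃)*, arXiv:2408.15403 (2024), §6.6, Lemma 65.
-/

namespace Literature.NumberTheory.Transcendental

namespace CalegariDimitrovTang

open Finset

/-- Rearrangement for monotone sequences: the sum of a nondecreasing `g : Fin N → ℕ` over any set
of positions `Q` is at most its sum over the final segment `{j ≥ b}` of the same cardinality.
[folklore] -/
theorem sum_le_sum_filter_le {N : ℕ} (g : Fin N → ℕ) (hg : Monotone g) (b : ℕ)
    (Q : Finset (Fin N)) (hQ : Q.card = (univ.filter fun j : Fin N => b ≤ (j : ℕ)).card) :
    ∑ j ∈ Q, g j ≤ ∑ j ∈ univ.filter (fun j : Fin N => b ≤ (j : ℕ)), g j := by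
  set P := univ.filter (fun j : Fin N => b ≤ (j : ℕ)) with hP
  have h1 : ∑ j ∈ Q, g j = ∑ j ∈ Q ∩ P, g j + ∑ j ∈ Q \ P, g j :=
    (Finset.sum_inter_add_sum_sdiff Q P g).symm
  have h2 : ∑ j ∈ P, g j = ∑ j ∈ P ∩ Q, g j + ∑ j ∈ P \ Q, g j :=
    (Finset.sum_inter_add_sum_sdiff P Q g).symm
  have hcard : (Q \ P).card = (P \ Q).card := by
    have hq := Finset.card_sdiff_add_card_inter Q P
    have hp := Finset.card_sdiff_add_card_inter P Q
    rw [Finset.inter_comm] at hp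
    omega
  have hle : ∀ q ∈ Q \ P, ∀ r ∈ P \ Q, g q ≤ g r := by
    intro q hq r hr
    have hq' : ¬ b ≤ (q : ℕ) := by
      intro h
      exact (Finset.mem_sdiff.mp hq).2 (Finset.mem_filter.mpr ⟨mem_univ q, h⟩)
    have hr' : b ≤ (r : ℕ) := (Finset.mem_filter.mp (Finset.mem_sdiff.mp hr).1).2
    exact hg (Fin.le_def.mpr (by omega))
  rw [h1, h2, Finset.inter_comm P Q]
  gcongr ∑ j ∈ Q ∩ P, g j + ?_
  by_cases he : (P \ Q).Nonempty
  · obtain ⟨r₀, hr₀, hmin⟩ := (P \ Q).exists_min_image g he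
    calc ∑ j ∈ Q \ P, g j ≤ (Q \ P).card • g r₀ :=
          Finset.sum_le_card_nsmul _ _ _ fun q hq => hle q hq r₀ hr₀
      _ = (P \ Q).card • g r₀ := by rw [hcard]
      _ ≤ ∑ j ∈ P \ Q, g j := Finset.card_nsmul_le_sum _ _ _ fun r hr => hmin r hr
  · rw [Finset.not_nonempty_iff_eq_empty] at he
    have hQP : Q \ P = ∅ := by
      rw [← Finset.card_eq_zero, hcard, he, Finset.card_empty]
    rw [hQP, he]

variable {m k : ℕ}

/-- The column-shaped lcm product `∏_{i ≤ m} ∏_{s ≤ k} [1,…,c_i · n(π((i-1)k+s))]` attached to a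
shape vector `c`, a sequence `n` of `km` integers and a permutation `π ∈ S_{km}` (positions encoded
row-major by `finProdFinEquiv`). [cite: CalegariDimitrovTang2024, §6.6 eq. (shapelcm) / Lemma 65] -/
def shapeLcmProd (c : Fin m → ℕ) (n : Fin (m * k) → ℕ) (π : Equiv.Perm (Fin (m * k))) : ℕ :=
  ∏ i : Fin m, ∏ s : Fin k, Nat.lcmUpto (c i * n (π (finProdFinEquiv (i, s))))

/-- `val_p` of the shape product is the sum of `⌊log_p (c_i n(π(i,s)))⌋`. [folklore] -/
theorem padicValNat_shapeLcmProd (p : ℕ) [hp : Fact p.Prime] (c : Fin m → ℕ) (n : Fin (m * k) → ℕ)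
    (π : Equiv.Perm (Fin (m * k))) :
    padicValNat p (shapeLcmProd c n π) =
      ∑ i : Fin m, ∑ s : Fin k, Nat.log p (c i * n (π (finProdFinEquiv (i, s)))) := by
  unfold shapeLcmProd
  rw [← Nat.factorization_def _ hp.out, Nat.factorization_prod fun i _ =>
    Finset.prod_ne_zero_iff.mpr fun s _ => Nat.lcmUpto_ne_zero _]
  rw [Finset.sum_apply']
  refine Finset.sum_congr rfl fun i _ => ?_
  rw [Nat.factorization_prod fun s _ => Nat.lcmUpto_ne_zero _, Finset.sum_apply']
  refine Finset.sum_congr rfl fun s _ => ?_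
  exact Nat.factorization_lcmUpto _ hp.out

/-- Row-major positions: `u·k ≤ s + k·i ↔ u ≤ i` for `s < k`. [folklore] -/
theorem le_finProdFinEquiv_iff (u : ℕ) (i : Fin m) (s : Fin k) :
    u * k ≤ ((finProdFinEquiv (i, s) : Fin (m * k)) : ℕ) ↔ u ≤ (i : ℕ) := by
  rw [finProdFinEquiv_apply_val]
  have hs : (s : ℕ) < k := s.isLt
  constructor
  · intro h
    by_contra hlt
    push Not at hlt
    have h1 : (i : ℕ) + 1 ≤ u := hlt
    have h2 : k * ((i : ℕ) + 1) ≤ k * u := Nat.mul_le_mul_left k h1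
    nlinarith
  · intro h
    have := Nat.mul_le_mul_left k h
    nlinarith

/-- **Lemma 65** (Calegari–Dimitrov–Tang). For a prime `p`, a column-shaped vector
`c = (0,…,0,c₀,…,c₀)` (`c i = 0` for `i < u`, `c i = c₀` for `i ≥ u`) and a nondecreasing sequence
`n` of `km` integers, every permutation `π ∈ S_{km}` of the positions gives a shape product
`∏_i ∏_s [1,…,c_i n(π(i,s))]` of `p`-adic valuation at most that of the identity permutation;
i.e. `π = id` maximizes the valuation. [cite: CalegariDimitrovTang2024, §6.6 Lemma 65] -/
theorem padicValNat_shapeLcmProd_le (p : ℕ) [hp : Fact p.Prime] {c : Fin m → ℕ} {u c₀ : ℕ}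
    (hc : ∀ i : Fin m, c i = if (i : ℕ) < u then 0 else c₀) {n : Fin (m * k) → ℕ} (hn : Monotone n)
    (π : Equiv.Perm (Fin (m * k))) :
    padicValNat p (shapeLcmProd c n π) ≤ padicValNat p (shapeLcmProd c n 1) := by
  classical
  -- the monotone summand
  set g : Fin (m * k) → ℕ := fun j => Nat.log p (c₀ * n j) with hg
  have hgmono : Monotone g := fun a b hab => Nat.log_mono_right (Nat.mul_le_mul_left c₀ (hn hab))
  -- the block of positions of the rows `i ≥ u`
  set B : Finset (Fin m × Fin k) := univ.filter (fun x => u ≤ (x.1 : ℕ)) with hB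
  set e : Fin m × Fin k ≃ Fin (m * k) := finProdFinEquiv with he
  -- rewrite both valuations as sums of `g` over position sets
  have hval : ∀ σ : Equiv.Perm (Fin (m * k)),
      padicValNat p (shapeLcmProd c n σ) = ∑ x ∈ B, g (σ (e x)) := by
    intro σ
    rw [padicValNat_shapeLcmProd, ← Finset.sum_product', Finset.univ_product_univ, hB, Finset.sum_filter]
    refine Finset.sum_congr rfl fun x _ => ?_
    rw [hc x.1]
    split_ifs with h1 h2 h2
    · exfalso; omega
    · simp
    · rfl
    · exfalso; omega
  rw [hval π, hval 1]
  simp only [Equiv.Perm.coe_one, id_eq]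
  -- `Σ_{x ∈ B} g (π (e x)) = Σ_{j ∈ (B.map e).map π} g j`
  have hlhs : ∑ x ∈ B, g (π (e x)) = ∑ j ∈ (B.map e.toEmbedding).map π.toEmbedding, g j := by
    rw [Finset.sum_map, Finset.sum_map]
    rfl
  have hrhs : ∑ x ∈ B, g (e x) = ∑ j ∈ B.map e.toEmbedding, g j := by
    rw [Finset.sum_map]
    rfl
  -- `B.map e` is the final segment `{j ≥ u k}`
  have hBe : B.map e.toEmbedding = univ.filter (fun j : Fin (m * k) => u * k ≤ (j : ℕ)) := by
    ext j
    simp only [Finset.mem_map_equiv, hB, Finset.mem_filter, Finset.mem_univ, true_and]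
    have hj : j = e (e.symm j) := (e.apply_symm_apply j).symm
    conv_rhs => rw [hj]
    rw [he]
    exact (le_finProdFinEquiv_iff u (finProdFinEquiv.symm j).1 (finProdFinEquiv.symm j).2).symm
  rw [hlhs, hrhs, hBe]
  refine sum_le_sum_filter_le g hgmono (u * k) _ ?_
  rw [Finset.card_map, ← hBe, Finset.card_map]

/-- The printed `max`-form of Lemma 65: the identity permutation attains the maximum of the
valuations over `S_{km}`. [cite: CalegariDimitrovTang2024, §6.6 Lemma 65] -/
theorem isGreatest_padicValNat_shapeLcmProd (p : ℕ) [Fact p.Prime] {c : Fin m → ℕ} {u c₀ : ℕ}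
    (hc : ∀ i : Fin m, c i = if (i : ℕ) < u then 0 else c₀) {n : Fin (m * k) → ℕ} (hn : Monotone n) :
    IsGreatest (Set.range fun π : Equiv.Perm (Fin (m * k)) => padicValNat p (shapeLcmProd c n π))
      (padicValNat p (shapeLcmProd c n 1)) :=
  ⟨⟨1, rfl⟩, by rintro _ ⟨π, rfl⟩; exact padicValNat_shapeLcmProd_le p hc hn π⟩

end CalegariDimitrovTang

end Literature.NumberTheory.Transcendental
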